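import Mathlib.Algebra.Polynomial.Expand
import Mathlib.Algebra.Polynomial.Div
import Mathlib.Algebra.Polynomial.Degree.Domain
import Mathlib.RingTheory.Ideal.Maps

/-!
# [AbsTopIII] §3: Remarks 3.7.5–3.7.8 (the discussion remarks following Corollary 3.7)

S. Mochizuki, *Topics in Absolute Anabelian Geometry III*, §3 "Nonarchimedean Log-Frobenius
Compatibility", pp. 94–100 of the author's manuscript (bib key `MochizukiAbsTopIII2015`; lit key
`paper:url-5493eb38cbb7`, 164 pp.; locators `p.N` are pages of that manuscript — the journal
pagination, J. Math. Sci. Univ. Tokyo 22 (2015), is not held).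

These fourteen sub-items (Rmk 3.7.5 (i)–(iv); 3.7.6 (i)–(v); 3.7.7 (i)–(iv); 3.7.8) are the
author's discussion of the MONO-ANABELIAN versus BI-ANABELIAN versus "PSEUDO-MONO-ANABELIAN"
approaches to reconstruction, in the light of Corollaries 3.6 / 3.7 (typed by seats abc-iut-L4-t5 /
abc-iut-L4-t9 as `AbsTopIII/FrobeniusPictureMLF.lean`, `AbsTopIII/MonoAnabelianComparisonMLF.lean`,
statement cores drafted by abc-iut-L4-t2).  Rmk 3.7.8 (p.100) says of all of them: "Many of the
arguments in the various remarks following Corollaries 3.6, 3.7 are not formulated entirely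
rigorously."  Following the cell's rule for remarks (one node per printed sub-item; "type the
mathematical claims a Remark actually makes, record the philosophy"), this file

* RECORDS each sub-item by a sectioning docstring quoting its thesis sentence(s) with locator
  (`Rmk_x_y_z : recorded, no claim`), naming the typed declaration it glosses where there is one;
* PROVES, as kernel-checked illustrations, the three elementary assertions the remarks make in a
  form precise enough to state: Rmk 3.7.5 (iv) — "the non-descendability of Galois-invariant
  coherent ideals with respect to morphisms such as `Spec(k[t]) → Spec(k[t^n])`" (typed: the ideal
  `(t) ⊆ k[t]` is invariant under every substitution `t ↦ ζt`, `ζ ∈ k^×`, but is not the extension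
  of any ideal along `k[t^n] ↪ k[t]`, `n ≥ 2`); Rmk 3.7.7 (i) — "the abstract outer action pair
  `G₂ ↷ Δ₂` is clearly isomorphic to the composite abstract outer action pair `G₁ ⥲ G₂ ↷ Δ₂`"
  (typed for pairs `(G, ρ : G →* E)`, `E` any group, e.g. `Out(Δ₂)`); Rmk 3.7.7 (iii) — the
  logical skeleton of the "purely group-theoretic specification" of the fixed points of a
  hyperelliptic involution (an injective equivariant assignment `x ↦ I_x` detects fixed points).

Dependency-free (Mathlib only): the remark records land independently of the Def 3.5 / Cor 3.6 /
Cor 3.7 import chain and re-declare nothing of it.  What is deliberately NOT here: any formal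
counterpart of the "pseudo-mono-anabelian approach", of Problem (∗type), of the "log-wall"
pictures, of the physical analogy (iii) of Rmk 3.7.5, or of the difficulties listed in Rmk 3.7.6
(pro-`Σ` Kummer maps, cyclotomes for number fields, `p`-adic Hodge theory and localization,
solenoids, Leopoldt) — the text offers these as heuristics, not as statements.  Nothing in this
file takes a side on the disputed parts of inter-universal Teichmüller theory; [AbsTopIII] is a
refereed, published paper and is cited as such.
-/

noncomputable section

namespace Literature.AnabelianGeometry.AbsoluteAnabelian.AbsTopIII

open Polynomial

/-! ### Remark 3.7.5 (i) (pp. 94–95) — recorded, no claim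

`Rmk_3_7_5_i : recorded, no claim.`  "From the point of view of 'constructing models of the base
field from `Π`' […], one natural approach to the issue of finding 'Galois-compatible models' is to
work with Kummer classes of scheme-theoretic functions, since Kummer classes are tautologically
compatible with Galois actions."  Kummer classes fit "into a container
`H(Π) := H¹(Π, μ_Ẑ(Π))` [cf. Corollary 1.10, (d)] which inherits the coricity of `Π`"; "once one
characterizes, in a 'group-theoretic' fashion, the Kummer subset of this container `H(Π)` […], it
remains to reconstruct the additive structure on [the union with `{0}` of] the set of Kummer
classes".  The approach "which combines the 'purely group-theoretic' [i.e., 'mono-anabelian']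
container `H(Π)` with the indirect use of 'models' to reconstruct the additive structure […]"
is called **pseudo-mono-anabelian**.  The "automorphism version of the Grothendieck Conjecture
[i.e., the functoriality of the algorithms of Corollary 1.10, applied to automorphisms] allows one
to conclude that the additive structure 'pulled back from a model scheme via the Kummer map' is
rigid", and the "isomorphism version […] [cf. the isomorphism `θ^bi` of Corollary 3.7, (ii)] allows
one to conclude that this additive structure is independent of the choice of model."  Glosses
Cor 1.10 (d) (seat L4-t1) and Cor 3.7 (ii) (`BiAnabelianData.θbi`, seat L4-t9).
-/

/-! ### Remark 3.7.5 (ii) (pp. 95–96) — recorded, no claim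

`Rmk_3_7_5_ii : recorded, no claim.`  "The pseudo-mono-anabelian approach gives rise to a theory
that satisfies many of the useful properties satisfied by the mono-anabelian theory"; but relative
to RELATING hidden models to log-subject copies "the central problem may be summarized as follows:
Problem (∗type): Find a type of mathematical object that […] serves as a common type of
mathematical object for both 'coric models' and 'log-subject copies', thus rendering possible the
comparison of 'coric models' and 'log-subject copies'."  In the mono-anabelian approach "this
'common type' is furnished by the objects that constitute `ℰ` and […] `Anab`; in the bi-anabelian
approach, the 'common object' is furnished by the 'copy of `𝒳` that appears in the base-change
`(−) ×_ℰ 𝒳`'"; "the definition of the diagonal functor `δ_𝒳` is possible precisely because of the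
equality of the types of mathematical object involved in the two factors of `𝒳 ×_ℰ 𝒳`".  If coric
models and log-subject copies "only share the container `H(Π)`, but not the description of its
contents", the "mysterious description" could be, e.g., "(1) […] the embedding obtained by
composing the usual Kummer map with the automorphism induced by some automorphism of the quotient
`Π ↠ G_k` […] which is not of scheme-theoretic origin [cf., e.g., [NSW], the Closing Remark
preceding Theorem 12.2.7]" or "(2) […] the embedding obtained by composing the usual Kummer map
with the automorphism of `H(Π)` given by multiplication by some element `∈ Ẑ^×`"; hence "there is
little choice but to include the ring/scheme-theoretic models in the common type", which "amounts
precisely to the 'bi-anabelian approach'".  Glosses Cor 3.7 (ii) (`BiAnabelianData.δ`, seat L4-t9).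
-/

/-! ### Remark 3.7.5 (iii) (p. 97) — recorded, no claim

`Rmk_3_7_5_iii : recorded, no claim.`  Physical analogy: "it is natural to think of data that
satisfies some sort of coricity — such as the étale fundamental group `Π` — as being 'massless',
like light.  By comparison, the arithmetic data '`k̄^×`' — on which the log-Frobenius functor acts
non-isomorphically — may be thought of as being like matter which has 'weight'":
"coricity, 'étale-like' structures ←→ massless, like light; 'Frobenius-like' structures ←→
matter of positive mass"; "the very existence of mono-anabelian algorithms as discussed in §1, §2
corresponds, in this analogy, to the 'conversion of light into matter'".
-/

/-! ### Remark 3.7.5 (iv) (p. 97) — recorded; the illustrative example PROVED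

`Rmk_3_7_5_iv : recorded.`  "The problem observed in the present paper with the bi-anabelian
approach may be thought of as an example of the phenomenon of the non-applicability of Galois
[i.e., 'étale-like'] descent with respect to 'Frobenius-like' morphisms [i.e., the existence of
descent data for a 'Frobenius-like' morphism which cannot be descended to an object on the
codomain of the morphism].  In classical arithmetic geometry, this phenomenon may be seen, for
instance, in the non-descendability of Galois-invariant coherent ideals with respect to morphisms
such as `Spec(k[t]) → Spec(k[t^n])` [where `n ≥ 2` is an integer; `k` is a field], or […] the
difference between an integrable connection and an integrable connection equipped with a
compatible Frobenius action [e.g., of the sort that arises from an `MF^∇`-object]."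
The first example is typed and proved below: `k[t^n] ↪ k[t]` is `Polynomial.expand k n`
(`t ↦ t^n`), "Galois-invariant" is invariance under the substitutions `t ↦ ζ·t` (`ζ ∈ k^×`, in
particular `ζ ∈ μ_n(k)`, the automorphisms of `k[t]` over `k[t^n]`), and "descends" means "is the
extension `J·k[t]` of an ideal `J ⊆ k[t^n]`".
-/

/-- Rmk 3.7.5 (iv), example, part 1: the coherent ideal `(t) ⊆ k[t]` is invariant under every
substitution `t ↦ ζ·t` with `ζ ∈ k^×` (in particular under the Galois group `μ_n(k)` of
`k[t]` over `k[t^n]`). [cite: MochizukiAbsTopIII2015, Rmk 3.7.5 (iv) p.97] -/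
theorem Rmk_3_7_5_iv_ideal_invariant (k : Type*) [Field k] {ζ : k} (hζ : ζ ≠ 0) :
    (Ideal.span {(X : k[X])}).map (aeval (C ζ * X) : k[X] →ₐ[k] k[X]) = Ideal.span {X} := by
  rw [Ideal.map_span, Set.image_singleton]
  change Ideal.span {aeval (C ζ * X) (X : k[X])} = _
  rw [aeval_X]
  exact Ideal.span_singleton_mul_left_unit (isUnit_C.mpr (IsUnit.mk0 ζ hζ)) X

/-- Rmk 3.7.5 (iv), example, part 2 ("non-descendability"): for `n ≥ 2` the ideal `(t) ⊆ k[t]` is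
not the extension of any ideal of `k[t^n]` along `k[t^n] ↪ k[t]` (typed with
`Polynomial.expand k n : k[t] → k[t]`, `t ↦ t^n`, whose image is `k[t^n]`): every extended ideal
containing no unit lies in `(t^n)`, which does not contain `t`.
[cite: MochizukiAbsTopIII2015, Rmk 3.7.5 (iv) p.97] -/
theorem Rmk_3_7_5_iv_ideal_not_descended (k : Type*) [Field k] {n : ℕ} (hn : 2 ≤ n)
    (J : Ideal k[X]) : J.map (expand k n : k[X] →ₐ[k] k[X]) ≠ Ideal.span {X} := by
  intro h
  have hpos : 0 < n := by omega
  -- every element of `J` has vanishing constant term, since its expansion lies in `(t)`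
  have hJ : ∀ j ∈ J, expand k n j ∈ Ideal.span {(X : k[X]) ^ n} := by
    intro j hj
    have hj' : expand k n j ∈ Ideal.span {(X : k[X])} := h ▸ Ideal.mem_map_of_mem _ hj
    rw [Ideal.mem_span_singleton, X_dvd_iff, coeff_expand hpos, if_pos (dvd_zero n),
      Nat.zero_div] at hj'
    obtain ⟨j', rfl⟩ := X_dvd_iff.mpr hj'
    rw [Ideal.mem_span_singleton, map_mul, expand_X]
    exact dvd_mul_right _ _
  have hle : J.map (expand k n : k[X] →ₐ[k] k[X]) ≤ Ideal.span {(X : k[X]) ^ n} :=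
    Ideal.map_le_iff_le_comap.mpr fun j hj => hJ j hj
  have hX : (X : k[X]) ∈ Ideal.span {(X : k[X]) ^ n} :=
    hle (h ▸ Ideal.mem_span_singleton_self X)
  rw [Ideal.mem_span_singleton] at hX
  have := natDegree_le_of_dvd hX X_ne_zero
  rw [natDegree_X_pow, natDegree_X] at this
  omega

/-! ### Remark 3.7.6 (i) (p. 97) — recorded, no claim typed

`Rmk_3_7_6_i : recorded.`  "In order to carry out the pseudo-mono-anabelian approach [or, a
fortiori, the mono-anabelian approach], it is necessary to use the full profinite étale fundamental
group of a hyperbolic orbicurve, say, of strictly Belyi type.  That is to say, if, for instance,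
one attempts to use the geometrically pro-`Σ` fundamental group of a hyperbolic curve [i.e., where
`Σ` is a set of primes which is not equal to the set of all primes], then the crucial injectivity of
the Kummer map [cf. Proposition 1.6, (i)] fails to hold.  In particular, this failure of injectivity
means that one cannot work with the crucial additive structure on [the union with `{0}` of] the
image of the Kummer map."  Glosses Prop 1.6 (i) (seat L4-t1); the failure is asserted for the
function-field Kummer map into pro-`Σ` cohomology and is not typed here (its precise form depends
on the base field).
-/

/-! ### Remark 3.7.6 (ii) (p. 97) — recorded, no claim

`Rmk_3_7_6_ii : recorded, no claim.`  "If one attempts to work, for instance, with the absolute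
Galois group of a number field — i.e., in the absence of any geometric fundamental group of a
hyperbolic orbicurve over the number field — then, in order to work with Kummer classes, one must
contend with the nontrivial issue of finding an appropriate [profinite] cyclotome [i.e., copy of
'`Ẑ(1)`'] to replace the 'curve-based cyclotome `M_X`' of Proposition 1.4, (ii) [cf. also Remark
1.9.5]."  Glosses Prop 1.4 (ii) (seat L4-t1).
-/

/-! ### Remark 3.7.6 (iii) (p. 98) — recorded, no claim

`Rmk_3_7_6_iii : recorded, no claim.`  "If one attempts to construct 'models of the base field' via
the theory of 'characters of `q`LT-type' as in [Mzk20], §3 […], then although [just as was the case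
with Kummer classes] such '`q`LT-models of the base field' are tautologically Galois-compatible and
admit a coricity inherited from the coricity of `Π`, [unlike the case with Kummer classes] the
essential use of `p`-adic Hodge theory implies that the resulting 'construction of the base field'
[…] is incompatible with the operation of passing from global [e.g., number] fields to local fields
[i.e., does not admit an analogue of the first portion of Corollary 1.10, (h)], hence also
incompatible with the operation of relating the resulting 'constructions of the base field' at
different localizations of a number field.  Such localization [i.e., in the terminology of §5,
'panalocalization'] properties will play a key role in the theory of §5."
-/

/-! ### Remark 3.7.6 (iv) (p. 98) — recorded, no claim typed

`Rmk_3_7_6_iv : recorded.`  "Geometrically pro-`Σ` fundamental groups as in (i) also fail to be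
compatible with localization.  Indeed, even if some sort of pro-`Σ` analogue of the theory of §1 is,
in the future, obtained for the primes lying over prime numbers `∈ Σ`, such an analogue is
impossible at the primes lying over prime numbers `∉ Σ` [since, as is easily verified, at such
primes, the automorphisms of `G_k` [notation of Corollary 1.10] that are not of scheme-theoretic
origin may extend, in general, to automorphisms of the full arithmetic [geometrically pro-`Σ`]
fundamental group]."  The bracketed "easily verified" assertion is stated "in general" and is not
typed.
-/

/-! ### Remark 3.7.6 (v) (p. 98) — recorded, no claim

`Rmk_3_7_6_v : recorded, no claim.`  "At the time of writing, it appears to be rather difficult to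
give a mono-anabelian 'group-theoretic' algorithm as in Theorem 1.9 in the case of number fields by
somehow 'gluing together' [mono-anabelian, 'group-theoretic'] algorithms […] applied at
nonarchimedean completions of the number field."  With abelianizations and class field theory
"[i.e., in the fashion of [Uchi], in the case of function fields] […] one may only recover the
'global copy' of `F^×` embedded in the idèles up to an indeterminacy that involves, in particular,
various 'solenoids' [cf., e.g., [ArTt], Chapter Nine, Theorem 3]"; with local and global Kummer
classes "it is not clear how to lift local Kummer classes to global Kummer classes; […] the
indeterminacies that occur for such liftings are of a nature roughly reminiscent of the global
Kummer classes whose vanishing is implied by the so-called Leopoldt Conjecture […], which is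
unknown in general at the time of writing."
-/

/-! ### Remark 3.7.7 (i) (pp. 98–99) — recorded; the tautology PROVED

`Rmk_3_7_7_i : recorded.`  "One way to interpret the fact that the log-Frobenius operation `log`
is not a ring homomorphism […] is to think of `log` as constituting a sort of 'wall' that
separates the two 'distinct scheme theories' that occur before and after its application.  The
étale fundamental groups that arise in these 'distinct scheme theories' thus necessarily
correspond to distinct, unrelated basepoints."  If `G_i ↷^out Δ_i` (`i = 1, 2`) are copies of
the outer Galois action of Theorem 1.9 on the two sides, "although this log-wall cannot be
penetrated by ring structures [i.e., by 'scheme theory'], it can be penetrated by the abstract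
profinite group structure of the `G_i` — cf. the Galois-equivariance of the map '`log_k̄`' of
Definition 3.1, (i).  Moreover, since the 'abstract outer action pair' […] `G₂ ↷^out Δ₂` is
clearly isomorphic to the composite abstract outer action pair `G₁ ⥲ G₂ ↷^out Δ₂` [as well as, by
definition, the abstract outer action pair `G₁ ↷^out Δ₁`] […] we thus conclude that the log-wall
can be penetrated by the isomorphism class of the abstract outer action pair `G_i ↷^out Δ_i`."
The "clearly isomorphic" step is typed below for pairs `(G, ρ : G →* E)` with `E` a fixed group
(for the text, `E = Out(Δ₂)`), an isomorphism of pairs being an isomorphism of groups compatible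
with the two actions.
-/

/-- Rmk 3.7.7 (i), the step "the abstract outer action pair `G₂ ↷^out Δ₂` is clearly isomorphic to
the composite abstract outer action pair `G₁ ⥲ G₂ ↷^out Δ₂`".  Two **action pairs**
`(G₁, ρ₁ : G₁ →* E)`, `(G₂, ρ₂ : G₂ →* E)` over the same target group `E` (for the text
`E = Out(Δ₂)`, so that `ρ_i` is an outer action `G_i ↷^out Δ₂`) are isomorphic if some group
isomorphism `e' : G₁ ≃* G₂` carries `ρ₁` to `ρ₂` (`ρ₂ ∘ e' = ρ₁`); for `ρ₁ := ρ₂ ∘ e` the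
isomorphism `e` itself is such a witness. [cite: MochizukiAbsTopIII2015, Rmk 3.7.7 (i) p.99] -/
theorem Rmk_3_7_7_i_logWall_pair {G₁ G₂ E : Type*} [Group G₁] [Group G₂] [Group E]
    (e : G₁ ≃* G₂) (ρ₂ : G₂ →* E) :
    ∃ e' : G₁ ≃* G₂, ρ₂.comp e'.toMonoidHom = ρ₂.comp e.toMonoidHom :=
  ⟨e, rfl⟩

/-! ### Remark 3.7.7 (ii) (pp. 99–100) — recorded, no claim

`Rmk_3_7_7_ii : recorded, no claim.`  "It is natural to proceed to consider what sort of
'additional data' may be shared on both sides of the log-wall.  Typically, 'purely group-theoretic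
structures' constructed from '`G_i ↷^out Δ_i`' serve as natural containers for such additional
data"; the additional data is "some sort of a choice among various possibilities housed in such a
group-theoretic container", and "The fundamental difference that distinguishes the
pseudo-mono-anabelian approach discussed in Remark 3.7.5 from the mono-anabelian approach is the
issue of whether this 'choice' is specified in terms that depend on the scheme theory that gives
rise to the choice [i.e., the pseudo-mono-anabelian case] or not [i.e., the mono-anabelian case
[…]]."  A second example of scheme-dependent additional data, for the birational geometric
fundamental groups `Δ_{η_X}` of Theorem 1.11: "the specification of some finite collection of
closed points corresponding to the cusps of some affine hyperbolic curve that lies in some given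
scheme theory [cf. Remark 1.11.5]."  Glosses Thm 1.11 / Rmk 1.11.5 (seat L4-t1).
-/

/-! ### Remark 3.7.7 (iii) (p. 100) — recorded; the logical skeleton PROVED

`Rmk_3_7_7_iii : recorded.`  "In certain special cases, a 'purely group-theoretic' specification
is in fact possible.  For instance, if, in the notation of Theorem 1.11, `X` is a hyperelliptic
curve whose unique nontrivial `k`-automorphism is given by its hyperelliptic involution, then the
set of points fixed by the hyperelliptic involution constitutes such an example in which a 'purely
group-theoretic' specification can be made by considering the conjugacy classes of inertia groups
'`I_x`' fixed by the unique nontrivial outer automorphism of `Δ_{η_X}` that commutes with the given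
outer action of `G_k` on `Δ_{η_X}`."  The anabelian inputs (injectivity and equivariance of
`x ↦ [I_x]`, Thm 1.11; uniqueness of the commuting outer automorphism) are seat L4-t1's facts; the
deduction from them is the lemma below.
-/

/-- Rmk 3.7.7 (iii), logical skeleton: if the assignment `x ↦ I x` (points to conjugacy classes of
inertia groups) is injective and an automorphism `σ` of the target acts through an involution
`ι` of the points (`σ (I x) = I (ι x)` — functoriality for the hyperelliptic involution), then the
classes fixed by `σ` are exactly those of the points fixed by `ι`.
[cite: MochizukiAbsTopIII2015, Rmk 3.7.7 (iii) p.100] -/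
theorem Rmk_3_7_7_iii_fixed_iff {Pt C : Type*} (I : Pt → C) (hI : Function.Injective I)
    (σ : C → C) (ι : Pt → Pt) (hσ : ∀ x, σ (I x) = I (ι x)) (x : Pt) :
    σ (I x) = I x ↔ ι x = x := by
  rw [hσ]
  exact hI.eq_iff

/-! ### Remark 3.7.7 (iv) (p. 100) — recorded, no claim

`Rmk_3_7_7_iv : recorded, no claim.`  "The 'log-wall' discussed in (i) is reminiscent of the
constant indeterminacy arising from morphisms of Frobenius type [i.e., which thus constitute a
'wall' that cannot be penetrated by constant rigidity] in the theory of the étale theta function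
[cf. [Mzk18], Corollary 5.12 and the following remarks], as well as of the subtleties that arise
from the Frobenius morphism in the context of anabelian geometry in positive characteristic [cf.,
e.g., [Stix]]."  Glosses [EtTh] Cor 5.12 (layer L2).
-/

/-! ### Remark 3.7.8 (p. 100) — recorded, no claim

`Rmk_3_7_8 : recorded, no claim.`  "Many of the arguments in the various remarks following
Corollaries 3.6, 3.7 are not formulated entirely rigorously.  Thus, in the future, it is quite
possible that certain of the obstacles pointed out in these remarks can be overcome.  Nevertheless,
we presented these remarks in the hope that they could aid in elucidating the content of and
motivation [from the point of view of the author] behind the various rigorously formulated results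
of the present paper."
-/

end Literature.AnabelianGeometry.AbsoluteAnabelian.AbsTopIII

end
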